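import Mathlib
import HarnessLib
import Literature.NumberTheory.LFunctions.BourgainTheorem4

/-!
# Bourgain's Theorem 4: the optimisation in `N` (eqs. (3.12) ⇒ (3.13) and (3.16) ⇒ (3.18))

Topic `Literature/NumberTheory/LFunctions`. Companion to `BourgainTheorem4.lean`, which records
the architecture of the printed proof of Theorem 4 of Bourgain, *Decoupling, exponential sums
and the Riemann zeta function*, J. Amer. Math. Soc. **30** (2017), §4 (= §3 of the journal
numbering: eqs. (3.1)–(3.19)), for `F = log`, and proves its last step
(`Literature.NumberTheory.LFunctions.Bourgain2017_theorem4_log_of_eq313_of_eq318`: Theorem 4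
from (3.13) and (3.18)). This file proves the step before it — the paper's pp. 11–13, the
choice of the length `N` of the short intervals — so that Theorem 4
(`Literature.NumberTheory.LFunctions.Bourgain2017_theorem4_log`, `ZetaSubconvexity.lean`) now
rests on exactly the two displayed estimates (3.12) and (3.16) of the paper, each valid for every
admissible `N`:

* **(3.12)** "`|S|⁶ ≪ max{M^{6+ε}/N³, (M^{5+ε}R⁴N/Q⁷)(MRQ/N³)} ≤ (M^{6+ε}/N³)(N/R)` for
  `N = MT^{-2/7}`" — the output of (3.4)–(3.11): the Bombieri–Iwaniec reduction in the form of
  Huxley–Watt [H-W] §4, the double large sieve (3.8) ([B-I1] Lemma 2.4, in this tree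
  `Literature.NumberTheory.LFunctions.DoubleLargeSieve.doubleLargeSieve`, `DoubleLargeSieve.lean`),
  the first spacing bound (3.10) from the decoupling Corollary 3
  (`Literature.NumberTheory.LFunctions.Bourgain2017_eq310_count_of_corollary3`), and Huxley–Watt's
  second spacing bound (3.11);
* **(3.16)** "`|S|⁶ ≪ min{M^{ε+11/2}N R^{-7/2}, M^{ε+11/2} R^{-1} N^{-1/2}} +
  (M^{6+ε}/N³)(N/R)^{2/3}`" — the same with Huxley's resonance-curve treatment [H1] §7 of the
  second spacing problem ((3.14)–(3.15));

both under the standing assumptions of §4: `T` sufficiently large, `M ≤ √T`, `N ∈ (1, M)`, and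
`R ≤ N ≤ R²` where **(3.3)** `R = ⌈(2M³/(cNT))^{1/2}⌉`
(`Literature.NumberTheory.LFunctions.bourgainR`), `c ∈ (0, 1]` being the constant of (3.1)
(the lower bound for the second, third and fourth derivatives of `F`; for `F = log` any `c < 1`).

## Results (all PROVED; no named fact is introduced)

* `Literature.NumberTheory.LFunctions.bourgainR` — DEFINITION (3.3), with `sqrt_le_bourgainR`,
  `bourgainR_lt` (`ρ ≤ R < ρ + 1`, `ρ = (2M³/(cNT))^{1/2}`) and `bourgainR_le_and_le_sq`
  (`ρ + 1 ≤ N ≤ ρ²` implies `R ≤ N ≤ R²`).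
* `Literature.NumberTheory.LFunctions.Bourgain2017_eq313_log_of_eq312` — **(3.12) ⇒ (3.13)**:
  "`|S| ≪ M^{1/2} T^{ε+13/84}` for `√T ≥ M ≥ cT^{3/7}`", including the printed verification that
  for such `M` "the conditions `N ∈ (1, M)` and `R ≤ N ≤ R²` are satisfied, with `N = MT^{-2/7}`".
* `Literature.NumberTheory.LFunctions.Bourgain2017_eq318_log_of_eq316` — **(3.16) ⇒ (3.18)**, the
  three cases "`|S|⁶ ≪ M^{3+ε}T^{53/57}` (`√T ≥ M > T^{49/114}`), `M^{4+ε}T^{1/2}`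
  (`T^{49/114} ≥ M ≥ T^{5/12}`), `M^{2+ε}T^{4/3}` (`T^{5/12} > M ≥ 2(cT)^{1/3}`)", through
  `eq318_log_case1_of_eq316` (`N = MT^{-17/57}`), `eq318_log_case2_of_eq316`
  (`N = M^{1/2}T^{-1/12}`), `eq318_log_case3_of_eq316` (`N = (2M³/(cT))^{1/2}`, `R = ⌈√N⌉`), as
  on pp. 12–13 of the paper ("one can check that if `T` is sufficiently large (in terms of
  `c⁻¹`) … then `N` does satisfy our initial assumptions"; here `T ≥ (8/c)^{10}`).
* `Literature.NumberTheory.LFunctions.Bourgain2017_theorem4_log_of_eq312_of_eq316` — **Theorem 4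
  (for `F = log`) from (3.12) and (3.16)**, by composition with
  `Bourgain2017_theorem4_log_of_eq313_of_eq318`.

## Method

With `M = T^α` (`α = log M/log T`, `Literature.NumberTheory.LFunctions.exists_eq_rpow_of_one_lt`)
and `N = T^ν`, `ρ = (2/c)^{1/2} T^{(3α-ν-1)/2}`
(`Literature.NumberTheory.LFunctions.sqrt_param_eq`); `R` enters the bounds only through
`R ≥ ρ ≥ T^{(3α-ν-1)/2}` (`Literature.NumberTheory.LFunctions.eq316_replace`) and the side
conditions through `ρ + 1 ≤ N ≤ ρ²`; every comparison of monomials is then a linear inequality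
between exponents. The exponent bookkeeping certified here: `ν - e = 3/57` and both terms
`= T^{3α+53/57}` in case 1; `ν - e = 3/8 - 3α/4 ∈ [1/19, 1/16]` and both terms `≤ T^{4α+1/2}` in
case 2 (this is where `49/114` and `5/12` come from: `MT^{-17/57} ≥ M^{1/2}T^{-1/12}` iff
`α ≥ 49/114`, `N ≤ ρ²` iff `α ≥ 5/12`); `M^{11/2}/N ≤ T^{4α+1/2} ≤ T^{2α+4/3}` iff `α ≤ 5/12`
and `M⁶N^{-8/3} ≤ T^{2α+4/3}` in case 3; `(M^{6+ε}/N³)(N/ρ) ≤ M^{3+ε}T^{13/14}` and `N ≤ ρ²`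
iff `M ≥ (c/2)T^{3/7}` for (3.13).

## Faithfulness notes

* As in `ZetaSubconvexity.lean` / `BourgainTheorem4.lean`: `S = ∑_{M/2 ≤ m ≤ M} e(T log(m/M))`
  is `Literature.NumberTheory.LFunctions.bourgainSum Real.log T M`, and `≪` with "`T`
  sufficiently large" is `∀ ε > 0, ∃ C T₀, ∀ T ≥ T₀`.
* (3.12) and (3.16) are hypotheses (`h312`, `h316`), stated for real `N` as the paper uses them
  (it substitutes the non-integral values above); the `M^ε` of `M^{k+ε}` is factored out. They
  are intermediate displays resting on [H-W] §§2–4, [H1] §7 and the decoupling theorem, none of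
  which is in Mathlib or in this tree, so — as for (3.13), (3.18) in `BourgainTheorem4.lean` — they
  are not vendored as named facts (D-0026) but enter as hypotheses of proved implications.
* The paper's case 1 of (3.18) carries the range `M ≤ √T` only because (3.16) is available there;
  `eq318_log_case1_of_eq316` does not need it. In case 3 the paper takes `M ≥ 2(cT)^{1/3}`; the
  last step of the proof of Theorem 4 uses it only from `M ≥ 2T^{1/3}`.
* Constants: the conclusions carry `2C` (two terms) and the threshold `max(T₀, (8/c)^{10})`;
  the paper does not make them explicit.

## References

* J. Bourgain, *Decoupling, exponential sums and the Riemann zeta function*, J. Amer. Math. Soc.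
  30 (2017), 205–224, doi:10.1090/jams/860 = arXiv:1408.5794, §4, eqs. (3.3), (3.12), (3.13),
  (3.16)–(3.19), Theorem 4. [cite: BourgainJAMS2017, §4 eqs. (3.12)–(3.19)]
* [H-W] M. N. Huxley, N. Watt, *Exponential sums and the Riemann zeta function*, Proc. London
  Math. Soc. (3) 57 (1988), 1–24. [H1] M. N. Huxley, *Exponential sums and the Riemann zeta
  function IV*, Proc. London Math. Soc. (3) 66 (1993), 1–40, §§7–8. [B-I1] E. Bombieri,
  H. Iwaniec, *On the order of `ζ(1/2 + it)`*, Ann. Sc. Norm. Sup. Pisa 13 (1986), 449–472.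
-/

noncomputable section

open Real

namespace Literature.NumberTheory.LFunctions

/-! ## The parameter `R` of (3.3) -/

/-- Bourgain's parameter `R = ⌈(2M³/(cNT))^{1/2}⌉` of eq. (3.3): once `N ∈ (1, M)` is chosen,
`R` is defined "so that, for each relevant size-`N` interval `I ⊂ [M/2, M]`, the corresponding
arc `J(I) = {f''(u)/2 : u ∈ I}` will be an interval of length exceeding `1/R²`"
(`f(u) = T F(u/M)`, `|F''| > c`). [cite: BourgainJAMS2017, §4 eq. (3.3)] -/
def bourgainR (c M N T : ℝ) : ℕ :=
  ⌈Real.sqrt (2 * M ^ 3 / (c * N * T))⌉₊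

/-- Unfolding lemma for `bourgainR`. [folklore] -/
theorem bourgainR_def (c M N T : ℝ) :
    bourgainR c M N T = ⌈Real.sqrt (2 * M ^ 3 / (c * N * T))⌉₊ := rfl

/-- `(2M³/(cNT))^{1/2} ≤ R`. [folklore] -/
theorem sqrt_le_bourgainR (c M N T : ℝ) :
    Real.sqrt (2 * M ^ 3 / (c * N * T)) ≤ (bourgainR c M N T : ℝ) :=
  Nat.le_ceil _

/-- `R < (2M³/(cNT))^{1/2} + 1`. [folklore] -/
theorem bourgainR_lt (c M N T : ℝ) :
    (bourgainR c M N T : ℝ) < Real.sqrt (2 * M ^ 3 / (c * N * T)) + 1 :=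
  Nat.ceil_lt_add_one (Real.sqrt_nonneg _)

/-- The two standing conditions `R ≤ N ≤ R²` of §4 follow from `ρ + 1 ≤ N ≤ ρ²`,
`ρ = (2M³/(cNT))^{1/2}`. [folklore] -/
theorem bourgainR_le_and_le_sq {c M N T : ℝ}
    (h₁ : Real.sqrt (2 * M ^ 3 / (c * N * T)) + 1 ≤ N)
    (h₂ : N ≤ 2 * M ^ 3 / (c * N * T)) :
    (bourgainR c M N T : ℝ) ≤ N ∧ N ≤ (bourgainR c M N T : ℝ) ^ 2 := by
  refine ⟨(bourgainR_lt c M N T).le.trans h₁, ?_⟩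
  have h0 : 0 ≤ 2 * M ^ 3 / (c * N * T) := by
    linarith [Real.sqrt_nonneg (2 * M ^ 3 / (c * N * T))]
  calc N ≤ 2 * M ^ 3 / (c * N * T) := h₂
    _ = Real.sqrt (2 * M ^ 3 / (c * N * T)) ^ 2 := (Real.sq_sqrt h0).symm
    _ ≤ (bourgainR c M N T : ℝ) ^ 2 :=
        pow_le_pow_left₀ (Real.sqrt_nonneg _) (sqrt_le_bourgainR c M N T) 2

/-! ## Elementary tools: `M = T^α`, thresholds -/

/-- For `T > 1` and `M > 0`, `M = T^α` with `α = log M / log T`. [folklore] -/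
theorem exists_eq_rpow_of_one_lt {T M : ℝ} (hT : 1 < T) (hM : 0 < M) : ∃ α : ℝ, T ^ α = M :=
  ⟨Real.logb T M, Real.rpow_logb (by linarith) hT.ne' hM⟩

/-- From `T ≥ (8/c)^{10}` (`0 < c ≤ 1`): `T > 1` and `8/c ≤ T^{1/10}`. [folklore] -/
theorem threshold_basic {c T : ℝ} (hc : 0 < c) (hc1 : c ≤ 1) (hT : (8 / c) ^ 10 ≤ T) :
    1 < T ∧ 8 / c ≤ T ^ (1 / 10 : ℝ) := by
  have h8 : (8 : ℝ) ≤ 8 / c := by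
    rw [le_div_iff₀ hc]; nlinarith
  have h1 : (1 : ℝ) < (8 / c) ^ 10 := one_lt_pow₀ (by linarith) (by norm_num)
  refine ⟨h1.trans_le hT, ?_⟩
  calc 8 / c = ((8 / c) ^ 10) ^ (1 / 10 : ℝ) := by
        rw [one_div, show ((10 : ℝ))⁻¹ = ((10 : ℕ) : ℝ)⁻¹ by norm_num,
          Real.pow_rpow_inv_natCast (by linarith) (by norm_num)]
    _ ≤ T ^ (1 / 10 : ℝ) := Real.rpow_le_rpow (by positivity) hT (by norm_num)

/-- From `8/c ≤ T^{1/10}`, `T ≥ 1`: `2 (2/c)^{1/2} ≤ T^θ` for every `θ ≥ 1/20`. [folklore] -/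
theorem two_mul_sqrt_le_rpow {c T θ : ℝ} (hT : 1 ≤ T) (h : 8 / c ≤ T ^ (1 / 10 : ℝ))
    (hθ : 1 / 20 ≤ θ) : 2 * Real.sqrt (2 / c) ≤ T ^ θ := by
  have hT0 : 0 ≤ T := zero_le_one.trans hT
  have e1 : 2 * Real.sqrt (2 / c) = Real.sqrt (8 / c) := by
    rw [show (8 : ℝ) / c = 2 ^ 2 * (2 / c) by ring, Real.sqrt_mul (by norm_num), Real.sqrt_sq (by norm_num)]
  have e2 : T ^ θ = Real.sqrt (T ^ (2 * θ)) := by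
    rw [Real.sqrt_eq_rpow, ← Real.rpow_mul hT0]
    congr 1; ring
  rw [e1, e2]
  apply Real.sqrt_le_sqrt
  calc 8 / c ≤ T ^ (1 / 10 : ℝ) := h
    _ ≤ T ^ (2 * θ) := Real.rpow_le_rpow_of_exponent_le hT (by linarith)

/-! ## Removing the ceiling and the minimum from (3.16) -/

/-- If `‖S‖⁶ ≤ C M^ε (min{M^{11/2} N R^{-7/2}, M^{11/2} R^{-1} N^{-1/2}} + (M⁶/N³)(N/R)^{2/3})` with
`R ≥ ρ > 0`, then the same holds with `R` replaced by `ρ` and the minimum replaced by either of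
its entries. [folklore] -/
theorem eq316_replace {S C ε M N R ρ : ℝ} (hC : 0 ≤ C) (hM : 0 < M) (hN : 0 < N) (hρ : 0 < ρ)
    (hR : ρ ≤ R)
    (h : S ≤ C * M ^ ε * (min (M ^ (11 / 2 : ℝ) * N / R ^ (7 / 2 : ℝ))
        (M ^ (11 / 2 : ℝ) / (R * N ^ (1 / 2 : ℝ))) + M ^ 6 / N ^ 3 * (N / R) ^ (2 / 3 : ℝ))) :
    S ≤ C * M ^ ε * (M ^ (11 / 2 : ℝ) * N / ρ ^ (7 / 2 : ℝ) + M ^ 6 / N ^ 3 * (N / ρ) ^ (2 / 3 : ℝ)) ∧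
    S ≤ C * M ^ ε * (M ^ (11 / 2 : ℝ) / (ρ * N ^ (1 / 2 : ℝ)) +
        M ^ 6 / N ^ 3 * (N / ρ) ^ (2 / 3 : ℝ)) := by
  have hR0 : 0 < R := hρ.trans_le hR
  have hCM : 0 ≤ C * M ^ ε := mul_nonneg hC (Real.rpow_nonneg hM.le _)
  have h3 : M ^ 6 / N ^ 3 * (N / R) ^ (2 / 3 : ℝ) ≤ M ^ 6 / N ^ 3 * (N / ρ) ^ (2 / 3 : ℝ) := by
    apply mul_le_mul_of_nonneg_left _ (by positivity)
    apply Real.rpow_le_rpow (by positivity) _ (by norm_num)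
    exact div_le_div_of_nonneg_left hN.le hρ hR
  have h1 : M ^ (11 / 2 : ℝ) * N / R ^ (7 / 2 : ℝ) ≤ M ^ (11 / 2 : ℝ) * N / ρ ^ (7 / 2 : ℝ) := by
    apply div_le_div_of_nonneg_left (by positivity) (by positivity)
    exact Real.rpow_le_rpow hρ.le hR (by norm_num)
  have h2 : M ^ (11 / 2 : ℝ) / (R * N ^ (1 / 2 : ℝ)) ≤ M ^ (11 / 2 : ℝ) / (ρ * N ^ (1 / 2 : ℝ)) := by
    apply div_le_div_of_nonneg_left (by positivity) (by positivity)
    exact mul_le_mul_of_nonneg_right hR (by positivity)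
  constructor
  · refine h.trans (mul_le_mul_of_nonneg_left ?_ hCM)
    exact add_le_add ((min_le_left _ _).trans h1) h3
  · refine h.trans (mul_le_mul_of_nonneg_left ?_ hCM)
    exact add_le_add ((min_le_right _ _).trans h2) h3

/-- The value of `ρ = (2M³/(cNT))^{1/2}` when `M = T^α`, `N = T^ν`:
`ρ = (2/c)^{1/2} T^{(3α - ν - 1)/2}`. [folklore] -/
theorem sqrt_param_eq {c T α ν : ℝ} (hc : 0 < c) (hT : 0 < T) :
    Real.sqrt (2 * (T ^ α) ^ 3 / (c * T ^ ν * T)) =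
      Real.sqrt (2 / c) * T ^ ((3 * α - ν - 1) / 2) := by
  have hT0 : 0 ≤ T := hT.le
  have e1 : 2 * (T ^ α) ^ 3 / (c * T ^ ν * T) = (2 / c) * T ^ (3 * α - ν - 1) := by
    rw [show (3 * α - ν - 1) = α * (3 : ℕ) - (ν + 1) by push_cast; ring, Real.rpow_sub hT,
      Real.rpow_mul_natCast hT0, Real.rpow_add hT, Real.rpow_one]
    field_simp
  rw [e1, Real.sqrt_mul (by positivity), Real.sqrt_eq_rpow (T ^ _), ← Real.rpow_mul hT0]
  congr 2
  ring

/-! ## (3.13) from (3.12) -/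

/-- **Bourgain 2017, (3.12) ⇒ (3.13), for `F = log`.** Hypothesis `h312` is eq. (3.12) of the
paper, "`|S|⁶ ≪ (M^{6+ε}/N³)(N/R)` for `N = MT^{-2/7}`", in the `∀ ε > 0, ∃ C T₀, ∀ T ≥ T₀`
rendering of `≪` and under the standing assumptions of §4 made explicit (`M ≤ √T`,
`N ∈ (1, M)`, `R ≤ N ≤ R²` with `R = ⌈(2M³/(cNT))^{1/2}⌉` as in (3.3),
`Literature.NumberTheory.LFunctions.bourgainR`). Conclusion: eq. (3.13),
"`|S| ≪ M^{1/2} T^{ε + 13/84}` for `√T ≥ M ≥ cT^{3/7}`". The printed argument: "Recalling (3.3)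
the above bound for `|S|⁶` implies `|S|⁶ ≪ (M^{6+ε}/N³)(N³T/M³)^{1/2} = M^{ε+9/2}T^{1/2}/N^{3/2}
= M^{3+ε} T^{13/14}`. If `√T ≥ M ≥ cT^{3/7}` … then the conditions `N ∈ (1, M)` and
`R ≤ N ≤ R²` are satisfied, with `N = MT^{-2/7}` and `R` as in (3.3)." Here: `R ≥ ρ :=
(2M³/(cNT))^{1/2} = (2/c)^{1/2} M T^{-5/14}`, so `(M^{6+ε}/N³)(N/R) ≤ M^{6+ε} N^{-2} ρ^{-1} ≤
M^{3+ε} T^{4/7 + 5/14} = M^{3+ε} T^{13/14}`; `N = MT^{-2/7} ≥ cT^{1/7} ≥ 2` and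
`ρ + 1 ≤ N` (as `N/ρ = (c/2)^{1/2} T^{1/14} ≥ 2`) once `T ≥ (8/c)^{10}`, and `N ≤ ρ²` iff
`M ≥ (c/2) T^{3/7}`. Finally `M^ε ≤ T^{6ε}` (`M ≤ T`) and a sixth root.
[cite: BourgainJAMS2017, §4 eqs. (3.12), (3.13)] -/
theorem Bourgain2017_eq313_log_of_eq312 {c : ℝ} (hc : 0 < c) (hc1 : c ≤ 1)
    (h312 : ∀ ε : ℝ, 0 < ε → ∃ C T₀ : ℝ, ∀ T M N : ℝ, T₀ ≤ T → M ≤ Real.sqrt T →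
      N = M * T ^ (-(2 / 7) : ℝ) → 1 < N → N < M →
      (bourgainR c M N T : ℝ) ≤ N → N ≤ (bourgainR c M N T : ℝ) ^ 2 →
        ‖bourgainSum Real.log T M‖ ^ 6 ≤
          C * (M ^ (6 + ε) / N ^ 3 * (N / (bourgainR c M N T : ℝ)))) :
    ∀ ε : ℝ, 0 < ε → ∃ C T₀ : ℝ, ∀ T : ℝ, T₀ ≤ T → ∀ M : ℝ,
      c * T ^ (3 / 7 : ℝ) ≤ M → M ≤ Real.sqrt T →
        ‖bourgainSum Real.log T M‖ ≤ C * Real.sqrt M * T ^ (13 / 84 + ε) := by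
  intro ε hε
  obtain ⟨C, T₀, H⟩ := h312 ε hε
  set K : ℝ := (max C 1) ^ (1 / 6 : ℝ) with hK
  have hK0 : 0 ≤ K := Real.rpow_nonneg (zero_le_one.trans (le_max_right C 1)) _
  have hK6 : K ^ 6 = max C 1 := by
    rw [hK, one_div, show ((6 : ℝ))⁻¹ = ((6 : ℕ) : ℝ)⁻¹ by norm_num,
      Real.rpow_inv_natCast_pow (zero_le_one.trans (le_max_right C 1)) (by norm_num)]
  refine ⟨K, max T₀ ((8 / c) ^ 10), ?_⟩
  intro T hT M hMl hMu
  have hT₀ : T₀ ≤ T := (le_max_left _ _).trans hT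
  obtain ⟨hT1, h8⟩ := threshold_basic hc hc1 ((le_max_right _ _).trans hT)
  have hTpos : 0 < T := by linarith
  have hT0 : 0 ≤ T := hTpos.le
  -- `M > 0` and `M = T^α`, `α ≤ 1/2`
  have hMpos : 0 < M := lt_of_lt_of_le (by positivity) hMl
  obtain ⟨α, hMα⟩ := exists_eq_rpow_of_one_lt hT1 hMpos
  have hα : α ≤ 1 / 2 := by
    rw [← Real.rpow_le_rpow_left_iff hT1, hMα, ← Real.sqrt_eq_rpow]; exact hMu
  -- `N = MT^{-2/7} = T^{α - 2/7}` and `ρ = (2/c)^{1/2} T^{α - 5/14}`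
  set N : ℝ := M * T ^ (-(2 / 7) : ℝ) with hNdef
  have hN : N = T ^ (α - 2 / 7) := by
    rw [hNdef, ← hMα, ← Real.rpow_add hTpos]; ring_nf
  have hNpos : 0 < N := by rw [hN]; positivity
  set ρ : ℝ := Real.sqrt (2 * M ^ 3 / (c * N * T)) with hρdef
  have hρ : ρ = Real.sqrt (2 / c) * T ^ (α - 5 / 14) := by
    rw [hρdef, ← hMα, hN, sqrt_param_eq hc hTpos]; ring_nf
  have hk1 : 1 ≤ Real.sqrt (2 / c) := by
    rw [show (1 : ℝ) = Real.sqrt 1 by simp]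
    exact Real.sqrt_le_sqrt (by rw [le_div_iff₀ hc]; linarith)
  have hρ_ge : T ^ (α - 5 / 14) ≤ ρ := by
    rw [hρ]; exact le_mul_of_one_le_left (by positivity) hk1
  -- side conditions: `2 ≤ N < M`, `ρ + 1 ≤ N ≤ ρ²`
  have hN2 : 2 ≤ N := by
    have h1 : c * T ^ (1 / 10 : ℝ) ≤ N := by
      calc c * T ^ (1 / 10 : ℝ) ≤ c * T ^ (1 / 7 : ℝ) :=
            mul_le_mul_of_nonneg_left (Real.rpow_le_rpow_of_exponent_le hT1.le (by norm_num)) hc.le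
        _ = c * T ^ (3 / 7 : ℝ) * T ^ (-(2 / 7) : ℝ) := by
            rw [mul_assoc, ← Real.rpow_add hTpos]; norm_num
        _ ≤ N := mul_le_mul_of_nonneg_right hMl (by positivity)
    have h2 : (8 : ℝ) ≤ c * T ^ (1 / 10 : ℝ) := by
      have := h8; rwa [div_le_iff₀ hc, mul_comm] at this
    linarith
  have hN1 : 1 < N := by linarith
  have hNM : N < M := by
    rw [hN, ← hMα]; exact (Real.rpow_lt_rpow_left_iff hT1).2 (by norm_num)
  have hside1 : ρ + 1 ≤ N := by
    have h2k : 2 * Real.sqrt (2 / c) ≤ T ^ (1 / 14 : ℝ) :=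
      two_mul_sqrt_le_rpow hT1.le h8 (by norm_num)
    have h2ρ : 2 * ρ ≤ N := by
      calc 2 * ρ = 2 * Real.sqrt (2 / c) * T ^ (α - 5 / 14) := by rw [hρ]; ring
        _ ≤ T ^ (1 / 14 : ℝ) * T ^ (α - 5 / 14) := mul_le_mul_of_nonneg_right h2k (by positivity)
        _ = N := by rw [hN, ← Real.rpow_add hTpos]; ring_nf
    linarith
  have hside2 : N ≤ 2 * M ^ 3 / (c * N * T) := by
    rw [le_div_iff₀ (by positivity)]
    have e : N * (c * N * T) = c * M ^ 2 * T ^ (3 / 7 : ℝ) := by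
      have h27 : (T ^ (-(2 / 7) : ℝ)) ^ 2 * T = T ^ (3 / 7 : ℝ) := by
        rw [← Real.rpow_natCast, ← Real.rpow_mul hT0, ← Real.rpow_add_one hTpos.ne']
        norm_num
      calc N * (c * N * T) = c * M ^ 2 * ((T ^ (-(2 / 7) : ℝ)) ^ 2 * T) := by rw [hNdef]; ring
        _ = c * M ^ 2 * T ^ (3 / 7 : ℝ) := by rw [h27]
    rw [e]
    have h2M : c * T ^ (3 / 7 : ℝ) ≤ 2 * M := by linarith
    calc c * M ^ 2 * T ^ (3 / 7 : ℝ) = M ^ 2 * (c * T ^ (3 / 7 : ℝ)) := by ring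
      _ ≤ M ^ 2 * (2 * M) := mul_le_mul_of_nonneg_left h2M (by positivity)
      _ = 2 * M ^ 3 := by ring
  obtain ⟨hRN, hNR⟩ := bourgainR_le_and_le_sq hside1 hside2
  have hR : ρ ≤ (bourgainR c M N T : ℝ) := sqrt_le_bourgainR c M N T
  -- the bound (3.12) and its evaluation
  have hS6 := H T M N hT₀ hMu rfl hN1 hNM hRN hNR
  have main : M ^ (6 + ε) / N ^ 3 * (N / (bourgainR c M N T : ℝ)) ≤
      M ^ (3 + ε) * T ^ (13 / 14 : ℝ) := by
    calc M ^ (6 + ε) / N ^ 3 * (N / (bourgainR c M N T : ℝ))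
        ≤ M ^ (6 + ε) / N ^ 3 * (N / T ^ (α - 5 / 14)) := by
          apply mul_le_mul_of_nonneg_left _ (by positivity)
          exact div_le_div_of_nonneg_left hNpos.le (by positivity) (hρ_ge.trans hR)
      _ = M ^ (3 + ε) * T ^ (13 / 14 : ℝ) := by
          rw [hN, ← hMα]
          simp only [← Real.rpow_natCast, ← Real.rpow_mul hT0, ← Real.rpow_sub hTpos,
            ← Real.rpow_add hTpos]
          congr 1
          push_cast
          ring
  have hMε : M ^ (3 + ε) ≤ M ^ 3 * T ^ (6 * ε) := by
    rw [Real.rpow_add hMpos, show (3 : ℝ) = ((3 : ℕ) : ℝ) by norm_num, Real.rpow_natCast]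
    apply mul_le_mul_of_nonneg_left _ (by positivity)
    have hMT : M ≤ T := by
      rw [← hMα]
      calc T ^ α ≤ T ^ (1 : ℝ) := Real.rpow_le_rpow_of_exponent_le hT1.le (by linarith)
        _ = T := Real.rpow_one T
    calc M ^ ε ≤ T ^ ε := Real.rpow_le_rpow hMpos.le hMT hε.le
      _ ≤ T ^ (6 * ε) := Real.rpow_le_rpow_of_exponent_le hT1.le (by linarith)
  have h6 : ‖bourgainSum Real.log T M‖ ^ 6 ≤ (K * Real.sqrt M * T ^ (13 / 84 + ε)) ^ 6 := by
    rw [pow_six_sqrt_mul_rpow hMpos.le hT0, hK6]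
    calc ‖bourgainSum Real.log T M‖ ^ 6
        ≤ C * (M ^ (6 + ε) / N ^ 3 * (N / (bourgainR c M N T : ℝ))) := hS6
      _ ≤ max C 1 * (M ^ (6 + ε) / N ^ 3 * (N / (bourgainR c M N T : ℝ))) :=
          mul_le_mul_of_nonneg_right (le_max_left _ _) (by positivity)
      _ ≤ max C 1 * (M ^ (3 + ε) * T ^ (13 / 14 : ℝ)) :=
          mul_le_mul_of_nonneg_left main (by positivity)
      _ ≤ max C 1 * (M ^ 3 * T ^ (6 * ε) * T ^ (13 / 14 : ℝ)) :=
          mul_le_mul_of_nonneg_left (mul_le_mul_of_nonneg_right hMε (by positivity)) (by positivity)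
      _ = max C 1 * M ^ 3 * T ^ (13 / 14 + 6 * ε) := by
          rw [Real.rpow_add hTpos]; ring
  have hKY : 0 ≤ K * Real.sqrt M * T ^ (13 / 84 + ε) := by positivity
  exact (pow_le_pow_iff_left₀ (norm_nonneg _) hKY (by norm_num : (6 : ℕ) ≠ 0)).1 h6

/-! ## (3.18) from (3.16)

In the three lemmas below `h` is (3.16) at fixed `T`, `M` (and `ε`, `C ≥ 0`): for every
admissible `N` (`1 < N < M`, `R ≤ N ≤ R²`, `R = ⌈(2M³/(cNT))^{1/2}⌉`),
`‖S‖⁶ ≤ C M^ε (min{M^{11/2} N R^{-7/2}, M^{11/2} R^{-1} N^{-1/2}} + (M⁶/N³)(N/R)^{2/3})`. -/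

/-- **Case `√T ≥ M > T^{49/114}` of (3.18)**: `N = MT^{-17/57}` in (3.16) gives
`‖S‖⁶ ≤ 2C M^{3+ε} T^{53/57}` (the upper bound `M ≤ √T` is where (3.16) is available, and is not
needed for the computation). With `M = T^α`: `N = T^{α - 17/57}`,
`ρ = (2M³/(cNT))^{1/2} = (2/c)^{1/2} T^{α - 20/57}`, `N/ρ = (c/2)^{1/2} T^{3/57}`; both
`M^{11/2} N ρ^{-7/2}` and `(M⁶/N³)(N/ρ)^{2/3}` are `≤ T^{3α + 53/57}`; `N ≤ ρ²` as `α ≥ 23/57`.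
[cite: BourgainJAMS2017, §4 eqs. (3.16)–(3.18)] -/
theorem eq318_log_case1_of_eq316 {c C ε T M : ℝ} (hc : 0 < c) (hc1 : c ≤ 1) (hC : 0 ≤ C)
    (hT : (8 / c) ^ 10 ≤ T) (hMl : T ^ (49 / 114 : ℝ) < M)
    (h : ∀ N : ℝ, 1 < N → N < M → (bourgainR c M N T : ℝ) ≤ N →
      N ≤ (bourgainR c M N T : ℝ) ^ 2 →
      ‖bourgainSum Real.log T M‖ ^ 6 ≤ C * M ^ ε *
        (min (M ^ (11 / 2 : ℝ) * N / (bourgainR c M N T : ℝ) ^ (7 / 2 : ℝ))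
            (M ^ (11 / 2 : ℝ) / ((bourgainR c M N T : ℝ) * N ^ (1 / 2 : ℝ))) +
          M ^ 6 / N ^ 3 * (N / (bourgainR c M N T : ℝ)) ^ (2 / 3 : ℝ))) :
    ‖bourgainSum Real.log T M‖ ^ 6 ≤ 2 * C * M ^ (3 + ε) * T ^ (53 / 57 : ℝ) := by
  obtain ⟨hT1, h8⟩ := threshold_basic hc hc1 hT
  have hTpos : 0 < T := by linarith
  have hT0 : 0 ≤ T := hTpos.le
  have hMpos : 0 < M := lt_of_le_of_lt (by positivity) hMl
  obtain ⟨α, hMα⟩ := exists_eq_rpow_of_one_lt hT1 hMpos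
  have hαl : 49 / 114 < α := by
    rw [← Real.rpow_lt_rpow_left_iff hT1, hMα]; exact hMl
  -- the choice of `N`, and `ρ`
  set N : ℝ := T ^ (α - 17 / 57) with hN
  have hNpos : 0 < N := by positivity
  set ρ : ℝ := Real.sqrt (2 * M ^ 3 / (c * N * T)) with hρdef
  have hρ : ρ = Real.sqrt (2 / c) * T ^ (α - 20 / 57) := by
    rw [hρdef, ← hMα, hN, sqrt_param_eq hc hTpos]; ring_nf
  have hk1 : 1 ≤ Real.sqrt (2 / c) := by
    rw [show (1 : ℝ) = Real.sqrt 1 by simp]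
    exact Real.sqrt_le_sqrt (by rw [le_div_iff₀ hc]; linarith)
  have hρpos : 0 < ρ := by rw [hρ]; positivity
  have hρ_ge : T ^ (α - 20 / 57) ≤ ρ := by
    rw [hρ]; exact le_mul_of_one_le_left (by positivity) hk1
  -- side conditions
  have hN2 : 2 ≤ N := by
    have h1 : T ^ (1 / 10 : ℝ) ≤ N := Real.rpow_le_rpow_of_exponent_le hT1.le (by linarith)
    have h2 : (8 : ℝ) ≤ 8 / c := by rw [le_div_iff₀ hc]; nlinarith
    linarith
  have hN1 : 1 < N := by linarith
  have hNM : N < M := by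
    rw [hN, ← hMα]; exact (Real.rpow_lt_rpow_left_iff hT1).2 (by linarith)
  have hside1 : ρ + 1 ≤ N := by
    have h2k : 2 * Real.sqrt (2 / c) ≤ T ^ (3 / 57 : ℝ) :=
      two_mul_sqrt_le_rpow hT1.le h8 (by norm_num)
    have h2ρ : 2 * ρ ≤ N := by
      calc 2 * ρ = 2 * Real.sqrt (2 / c) * T ^ (α - 20 / 57) := by rw [hρ]; ring
        _ ≤ T ^ (3 / 57 : ℝ) * T ^ (α - 20 / 57) := mul_le_mul_of_nonneg_right h2k (by positivity)
        _ = N := by rw [hN, ← Real.rpow_add hTpos]; ring_nf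
    linarith
  have hside2 : N ≤ 2 * M ^ 3 / (c * N * T) := by
    rw [le_div_iff₀ (by positivity)]
    calc N * (c * N * T) = c * T ^ (2 * (α - 17 / 57) + 1) := by
          rw [Real.rpow_add hTpos, Real.rpow_one, show 2 * (α - 17 / 57) = (α - 17 / 57) + (α - 17 / 57)
            by ring, Real.rpow_add hTpos]; ring
      _ ≤ 1 * T ^ (α * 3) := by
          apply mul_le_mul hc1 _ (by positivity) zero_le_one
          exact Real.rpow_le_rpow_of_exponent_le hT1.le (by linarith)
      _ ≤ 2 * M ^ 3 := by
          rw [← hMα, ← Real.rpow_mul_natCast hT0]; push_cast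
          linarith [Real.rpow_nonneg hT0 (α * 3)]
  obtain ⟨hRN, hNR⟩ := bourgainR_le_and_le_sq hside1 hside2
  have hR : ρ ≤ (bourgainR c M N T : ℝ) := sqrt_le_bourgainR c M N T
  -- (3.16) at this `N`, with `R` replaced by `ρ` and the first entry of the minimum
  obtain ⟨hS, -⟩ := eq316_replace hC hMpos hNpos hρpos hR (h N hN1 hNM hRN hNR)
  have hX : T ^ (3 * α + 53 / 57) = M ^ 3 * T ^ (53 / 57 : ℝ) := by
    rw [← hMα, ← Real.rpow_mul_natCast hT0, ← Real.rpow_add hTpos]; push_cast; ring_nf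
  have h1 : M ^ (11 / 2 : ℝ) * N / ρ ^ (7 / 2 : ℝ) ≤ T ^ (3 * α + 53 / 57) := by
    calc M ^ (11 / 2 : ℝ) * N / ρ ^ (7 / 2 : ℝ)
        ≤ M ^ (11 / 2 : ℝ) * N / (T ^ (α - 20 / 57)) ^ (7 / 2 : ℝ) := by
          apply div_le_div_of_nonneg_left (by positivity) (by positivity)
          exact Real.rpow_le_rpow (by positivity) hρ_ge (by norm_num)
      _ = T ^ (3 * α + 53 / 57) := by
          rw [hN, ← hMα]
          simp only [← Real.rpow_mul hT0, ← Real.rpow_sub hTpos, ← Real.rpow_add hTpos]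
          congr 1; ring
  have h2 : M ^ 6 / N ^ 3 * (N / ρ) ^ (2 / 3 : ℝ) ≤ T ^ (3 * α + 53 / 57) := by
    calc M ^ 6 / N ^ 3 * (N / ρ) ^ (2 / 3 : ℝ)
        ≤ M ^ 6 / N ^ 3 * (N / T ^ (α - 20 / 57)) ^ (2 / 3 : ℝ) := by
          apply mul_le_mul_of_nonneg_left _ (by positivity)
          apply Real.rpow_le_rpow (by positivity) _ (by norm_num)
          exact div_le_div_of_nonneg_left hNpos.le (by positivity) hρ_ge
      _ = T ^ (3 * α + 53 / 57) := by
          rw [hN, ← hMα]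
          simp only [← Real.rpow_natCast, ← Real.rpow_mul hT0, ← Real.rpow_sub hTpos,
            ← Real.rpow_add hTpos]
          congr 1; push_cast; ring
  have hM3ε : M ^ (3 + ε) = M ^ 3 * M ^ ε := by
    rw [Real.rpow_add hMpos, show (3 : ℝ) = ((3 : ℕ) : ℝ) by norm_num, Real.rpow_natCast]
  have hCM : 0 ≤ C * M ^ ε := mul_nonneg hC (Real.rpow_nonneg hMpos.le _)
  calc ‖bourgainSum Real.log T M‖ ^ 6
      ≤ C * M ^ ε * (M ^ (11 / 2 : ℝ) * N / ρ ^ (7 / 2 : ℝ) + M ^ 6 / N ^ 3 * (N / ρ) ^ (2 / 3 : ℝ)) := hS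
    _ ≤ C * M ^ ε * (T ^ (3 * α + 53 / 57) + T ^ (3 * α + 53 / 57)) :=
        mul_le_mul_of_nonneg_left (add_le_add h1 h2) hCM
    _ = 2 * C * M ^ (3 + ε) * T ^ (53 / 57 : ℝ) := by rw [hX, hM3ε]; ring

/-- **Case `T^{49/114} ≥ M ≥ T^{5/12}` of (3.18)**: `N = M^{1/2} T^{-1/12}` in (3.16) gives
`‖S‖⁶ ≤ 2C M^{4+ε} T^{1/2}`. With `M = T^α`: `N = T^{α/2 - 1/12}`,
`ρ = (2/c)^{1/2} T^{5α/4 - 11/24}`, `N/ρ = (c/2)^{1/2} T^{3/8 - 3α/4}` with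
`3/8 - 3α/4 ≥ 1/19` (`α ≤ 49/114`); both `M^{11/2} ρ^{-1} N^{-1/2}` and `(M⁶/N³)(N/ρ)^{2/3}` are
`≤ T^{4α + 1/2}`; `N ≤ ρ²` as `α ≥ 5/12`. [cite: BourgainJAMS2017, §4 eqs. (3.16)–(3.18)] -/
theorem eq318_log_case2_of_eq316 {c C ε T M : ℝ} (hc : 0 < c) (hc1 : c ≤ 1) (hC : 0 ≤ C)
    (hT : (8 / c) ^ 10 ≤ T) (hMl : T ^ (5 / 12 : ℝ) ≤ M) (hMu : M ≤ T ^ (49 / 114 : ℝ))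
    (h : ∀ N : ℝ, 1 < N → N < M → (bourgainR c M N T : ℝ) ≤ N →
      N ≤ (bourgainR c M N T : ℝ) ^ 2 →
      ‖bourgainSum Real.log T M‖ ^ 6 ≤ C * M ^ ε *
        (min (M ^ (11 / 2 : ℝ) * N / (bourgainR c M N T : ℝ) ^ (7 / 2 : ℝ))
            (M ^ (11 / 2 : ℝ) / ((bourgainR c M N T : ℝ) * N ^ (1 / 2 : ℝ))) +
          M ^ 6 / N ^ 3 * (N / (bourgainR c M N T : ℝ)) ^ (2 / 3 : ℝ))) :
    ‖bourgainSum Real.log T M‖ ^ 6 ≤ 2 * C * M ^ (4 + ε) * T ^ (1 / 2 : ℝ) := by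
  obtain ⟨hT1, h8⟩ := threshold_basic hc hc1 hT
  have hTpos : 0 < T := by linarith
  have hT0 : 0 ≤ T := hTpos.le
  have hMpos : 0 < M := lt_of_lt_of_le (by positivity) hMl
  obtain ⟨α, hMα⟩ := exists_eq_rpow_of_one_lt hT1 hMpos
  have hαl : 5 / 12 ≤ α := by
    rw [← Real.rpow_le_rpow_left_iff hT1, hMα]; exact hMl
  have hαu : α ≤ 49 / 114 := by
    rw [← Real.rpow_le_rpow_left_iff hT1, hMα]; exact hMu
  -- the choice of `N`, and `ρ`
  set N : ℝ := T ^ (α / 2 - 1 / 12) with hN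
  have hNpos : 0 < N := by positivity
  set ρ : ℝ := Real.sqrt (2 * M ^ 3 / (c * N * T)) with hρdef
  have hρ : ρ = Real.sqrt (2 / c) * T ^ (5 * α / 4 - 11 / 24) := by
    rw [hρdef, ← hMα, hN, sqrt_param_eq hc hTpos]; ring_nf
  have hk1 : 1 ≤ Real.sqrt (2 / c) := by
    rw [show (1 : ℝ) = Real.sqrt 1 by simp]
    exact Real.sqrt_le_sqrt (by rw [le_div_iff₀ hc]; linarith)
  have hρpos : 0 < ρ := by rw [hρ]; positivity
  have hρ_ge : T ^ (5 * α / 4 - 11 / 24) ≤ ρ := by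
    rw [hρ]; exact le_mul_of_one_le_left (by positivity) hk1
  -- side conditions
  have hN2 : 2 ≤ N := by
    have h1 : T ^ (1 / 10 : ℝ) ≤ N := Real.rpow_le_rpow_of_exponent_le hT1.le (by linarith)
    have h2 : (8 : ℝ) ≤ 8 / c := by rw [le_div_iff₀ hc]; nlinarith
    linarith
  have hN1 : 1 < N := by linarith
  have hNM : N < M := by
    rw [hN, ← hMα]; exact (Real.rpow_lt_rpow_left_iff hT1).2 (by linarith)
  have hside1 : ρ + 1 ≤ N := by
    have h2k : 2 * Real.sqrt (2 / c) ≤ T ^ (3 / 8 - 3 * α / 4) :=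
      two_mul_sqrt_le_rpow hT1.le h8 (by linarith)
    have h2ρ : 2 * ρ ≤ N := by
      calc 2 * ρ = 2 * Real.sqrt (2 / c) * T ^ (5 * α / 4 - 11 / 24) := by rw [hρ]; ring
        _ ≤ T ^ (3 / 8 - 3 * α / 4) * T ^ (5 * α / 4 - 11 / 24) :=
            mul_le_mul_of_nonneg_right h2k (by positivity)
        _ = N := by rw [hN, ← Real.rpow_add hTpos]; ring_nf
    linarith
  have hside2 : N ≤ 2 * M ^ 3 / (c * N * T) := by
    rw [le_div_iff₀ (by positivity)]
    calc N * (c * N * T) = c * T ^ (2 * (α / 2 - 1 / 12) + 1) := by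
          rw [Real.rpow_add hTpos, Real.rpow_one,
            show 2 * (α / 2 - 1 / 12) = (α / 2 - 1 / 12) + (α / 2 - 1 / 12) by ring,
            Real.rpow_add hTpos]; ring
      _ ≤ 1 * T ^ (α * 3) := by
          apply mul_le_mul hc1 _ (by positivity) zero_le_one
          exact Real.rpow_le_rpow_of_exponent_le hT1.le (by linarith)
      _ ≤ 2 * M ^ 3 := by
          rw [← hMα, ← Real.rpow_mul_natCast hT0]; push_cast
          linarith [Real.rpow_nonneg hT0 (α * 3)]
  obtain ⟨hRN, hNR⟩ := bourgainR_le_and_le_sq hside1 hside2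
  have hR : ρ ≤ (bourgainR c M N T : ℝ) := sqrt_le_bourgainR c M N T
  -- (3.16) at this `N`, with `R` replaced by `ρ` and the second entry of the minimum
  obtain ⟨-, hS⟩ := eq316_replace hC hMpos hNpos hρpos hR (h N hN1 hNM hRN hNR)
  have hX : T ^ (4 * α + 1 / 2) = M ^ 4 * T ^ (1 / 2 : ℝ) := by
    rw [← hMα, ← Real.rpow_mul_natCast hT0, ← Real.rpow_add hTpos]; push_cast; ring_nf
  have h1 : M ^ (11 / 2 : ℝ) / (ρ * N ^ (1 / 2 : ℝ)) ≤ T ^ (4 * α + 1 / 2) := by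
    calc M ^ (11 / 2 : ℝ) / (ρ * N ^ (1 / 2 : ℝ))
        ≤ M ^ (11 / 2 : ℝ) / (T ^ (5 * α / 4 - 11 / 24) * N ^ (1 / 2 : ℝ)) := by
          apply div_le_div_of_nonneg_left (by positivity) (by positivity)
          exact mul_le_mul_of_nonneg_right hρ_ge (by positivity)
      _ = T ^ (4 * α + 1 / 2) := by
          rw [hN, ← hMα]
          simp only [← Real.rpow_mul hT0, ← Real.rpow_add hTpos, ← Real.rpow_sub hTpos]
          congr 1; ring
  have h2 : M ^ 6 / N ^ 3 * (N / ρ) ^ (2 / 3 : ℝ) ≤ T ^ (4 * α + 1 / 2) := by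
    calc M ^ 6 / N ^ 3 * (N / ρ) ^ (2 / 3 : ℝ)
        ≤ M ^ 6 / N ^ 3 * (N / T ^ (5 * α / 4 - 11 / 24)) ^ (2 / 3 : ℝ) := by
          apply mul_le_mul_of_nonneg_left _ (by positivity)
          apply Real.rpow_le_rpow (by positivity) _ (by norm_num)
          exact div_le_div_of_nonneg_left hNpos.le (by positivity) hρ_ge
      _ = T ^ (4 * α + 1 / 2) := by
          rw [hN, ← hMα]
          simp only [← Real.rpow_natCast, ← Real.rpow_mul hT0, ← Real.rpow_sub hTpos,
            ← Real.rpow_add hTpos]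
          congr 1; push_cast; ring
  have hM4ε : M ^ (4 + ε) = M ^ 4 * M ^ ε := by
    rw [Real.rpow_add hMpos, show (4 : ℝ) = ((4 : ℕ) : ℝ) by norm_num, Real.rpow_natCast]
  have hCM : 0 ≤ C * M ^ ε := mul_nonneg hC (Real.rpow_nonneg hMpos.le _)
  calc ‖bourgainSum Real.log T M‖ ^ 6
      ≤ C * M ^ ε * (M ^ (11 / 2 : ℝ) / (ρ * N ^ (1 / 2 : ℝ)) +
          M ^ 6 / N ^ 3 * (N / ρ) ^ (2 / 3 : ℝ)) := hS
    _ ≤ C * M ^ ε * (T ^ (4 * α + 1 / 2) + T ^ (4 * α + 1 / 2)) :=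
        mul_le_mul_of_nonneg_left (add_le_add h1 h2) hCM
    _ = 2 * C * M ^ (4 + ε) * T ^ (1 / 2 : ℝ) := by rw [hX, hM4ε]; ring

/-- **Case `T^{5/12} > M ≥ 2(cT)^{1/3}` of (3.18)**: the smaller `N = (2M³/(cT))^{1/2}` (for
which `(2M³/(cNT))^{1/2} = √N`, so `R = ⌈√N⌉` and `N ≤ R² ≪ N`) in (3.16) gives
`‖S‖⁶ ≤ 2C M^{2+ε} T^{4/3}`: here `N ≥ 4` (as `M³ ≥ 8cT`), `N < M` (as `M < T^{5/12} ≤ cT/2`),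
`√N + 1 ≤ N`; and with `M = T^α`, `N = (2/c)^{1/2} T^{(3α-1)/2} ≥ T^{(3α-1)/2}`:
`M^{11/2} (√N N^{1/2})^{-1} = M^{11/2}/N ≤ T^{4α + 1/2} ≤ T^{2α + 4/3}` (`α ≤ 5/12`) and
`(M⁶/N³)(N/√N)^{2/3} = M⁶ N^{-8/3} ≤ T^{2α + 4/3}`. [cite: BourgainJAMS2017, §4 eqs. (3.16)–(3.18)] -/
theorem eq318_log_case3_of_eq316 {c C ε T M : ℝ} (hc : 0 < c) (hc1 : c ≤ 1) (hC : 0 ≤ C)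
    (hT : (8 / c) ^ 10 ≤ T) (hMl : 2 * (c * T) ^ (1 / 3 : ℝ) ≤ M) (hMu : M < T ^ (5 / 12 : ℝ))
    (h : ∀ N : ℝ, 1 < N → N < M → (bourgainR c M N T : ℝ) ≤ N →
      N ≤ (bourgainR c M N T : ℝ) ^ 2 →
      ‖bourgainSum Real.log T M‖ ^ 6 ≤ C * M ^ ε *
        (min (M ^ (11 / 2 : ℝ) * N / (bourgainR c M N T : ℝ) ^ (7 / 2 : ℝ))
            (M ^ (11 / 2 : ℝ) / ((bourgainR c M N T : ℝ) * N ^ (1 / 2 : ℝ))) +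
          M ^ 6 / N ^ 3 * (N / (bourgainR c M N T : ℝ)) ^ (2 / 3 : ℝ))) :
    ‖bourgainSum Real.log T M‖ ^ 6 ≤ 2 * C * M ^ (2 + ε) * T ^ (4 / 3 : ℝ) := by
  obtain ⟨hT1, h8⟩ := threshold_basic hc hc1 hT
  have hTpos : 0 < T := by linarith
  have hT0 : 0 ≤ T := hTpos.le
  have hcT : 0 < c * T := by positivity
  have hMpos : 0 < M := lt_of_lt_of_le (by positivity) hMl
  obtain ⟨α, hMα⟩ := exists_eq_rpow_of_one_lt hT1 hMpos
  have hαu : α < 5 / 12 := by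
    rw [← Real.rpow_lt_rpow_left_iff hT1, hMα]; exact hMu
  -- the choice of `N`
  set N : ℝ := Real.sqrt (2 * M ^ 3 / (c * T)) with hNdef
  have hN0 : 0 ≤ N := Real.sqrt_nonneg _
  have hNsq : N ^ 2 = 2 * M ^ 3 / (c * T) := Real.sq_sqrt (by positivity)
  have hNsq' : N ^ 2 * (c * T) = 2 * M ^ 3 := (eq_div_iff hcT.ne').1 hNsq
  have hNT : N = Real.sqrt (2 / c) * T ^ ((3 * α - 1) / 2) := by
    rw [hNdef, ← hMα, show c * T = c * T ^ (0 : ℝ) * T by rw [Real.rpow_zero, mul_one],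
      sqrt_param_eq hc hTpos]
    ring_nf
  have hk1 : 1 ≤ Real.sqrt (2 / c) := by
    rw [show (1 : ℝ) = Real.sqrt 1 by simp]
    exact Real.sqrt_le_sqrt (by rw [le_div_iff₀ hc]; linarith)
  have hN_ge : T ^ ((3 * α - 1) / 2) ≤ N := by
    rw [hNT]; exact le_mul_of_one_le_left (by positivity) hk1
  -- `M³ ≥ 8cT`, `N ≥ 4`
  have hM3 : 8 * (c * T) ≤ M ^ 3 := by
    have h0 : 0 ≤ 2 * (c * T) ^ (1 / 3 : ℝ) := by positivity
    calc 8 * (c * T) = (2 * (c * T) ^ (1 / 3 : ℝ)) ^ 3 := by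
          rw [mul_pow, one_div, show ((3 : ℝ))⁻¹ = ((3 : ℕ) : ℝ)⁻¹ by norm_num,
            Real.rpow_inv_natCast_pow hcT.le (by norm_num)]
          norm_num
      _ ≤ M ^ 3 := pow_le_pow_left₀ h0 hMl 3
  have hN4 : 4 ≤ N := by
    have h16 : (4 : ℝ) ^ 2 ≤ N ^ 2 := by
      rw [hNsq, le_div_iff₀ hcT]; linarith
    exact (pow_le_pow_iff_left₀ (by norm_num) hN0 two_ne_zero).1 h16
  have hNpos : 0 < N := by linarith
  have hN1 : 1 < N := by linarith
  -- `N < M`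
  have hNM : N < M := by
    have h2c : 2 / c ≤ T ^ (1 / 10 : ℝ) := by
      have := h8
      rw [div_le_iff₀ hc] at this ⊢
      linarith
    have hcT' : 2 * T ^ (5 / 12 : ℝ) ≤ c * T := by
      calc 2 * T ^ (5 / 12 : ℝ) = 2 / c * T ^ (5 / 12 : ℝ) * c := by field_simp
        _ ≤ T ^ (1 / 10 : ℝ) * T ^ (5 / 12 : ℝ) * c :=
            mul_le_mul_of_nonneg_right (mul_le_mul_of_nonneg_right h2c (by positivity)) hc.le
        _ = T ^ (31 / 60 : ℝ) * c := by rw [← Real.rpow_add hTpos]; norm_num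
        _ ≤ T ^ (1 : ℝ) * c :=
            mul_le_mul_of_nonneg_right (Real.rpow_le_rpow_of_exponent_le hT1.le (by norm_num)) hc.le
        _ = c * T := by rw [Real.rpow_one]; ring
    have h2M : 2 * M < c * T := by linarith
    have hsq : N ^ 2 < M ^ 2 := by
      rw [hNsq, div_lt_iff₀ hcT]
      nlinarith [mul_lt_mul_of_pos_left h2M (by positivity : (0 : ℝ) < M ^ 2)]
    exact lt_of_pow_lt_pow_left₀ 2 hMpos.le hsq
  -- `ρ = √N`, `R = ⌈√N⌉`, `√N + 1 ≤ N ≤ (2M³/(cNT))`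
  have hρN : 2 * M ^ 3 / (c * N * T) = N := by
    rw [eq_comm, eq_div_iff (by positivity)]
    calc N * (c * N * T) = N ^ 2 * (c * T) := by ring
      _ = 2 * M ^ 3 := hNsq'
  set ρ : ℝ := Real.sqrt (2 * M ^ 3 / (c * N * T)) with hρdef
  have hρ : ρ = Real.sqrt N := by rw [hρdef, hρN]
  have hs2 : 2 ≤ Real.sqrt N := by
    rw [show (2 : ℝ) = Real.sqrt (2 ^ 2) by rw [Real.sqrt_sq (by norm_num)]]
    exact Real.sqrt_le_sqrt (by linarith)
  have hρpos : 0 < ρ := by rw [hρ]; linarith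
  have hside1 : ρ + 1 ≤ N := by
    rw [hρ]
    nlinarith [Real.sq_sqrt hN0, hs2]
  have hside2 : N ≤ 2 * M ^ 3 / (c * N * T) := le_of_eq hρN.symm
  obtain ⟨hRN, hNR⟩ := bourgainR_le_and_le_sq hside1 hside2
  have hR : ρ ≤ (bourgainR c M N T : ℝ) := sqrt_le_bourgainR c M N T
  -- (3.16) at this `N`, with `R` replaced by `ρ = √N` and the second entry of the minimum
  obtain ⟨-, hS⟩ := eq316_replace hC hMpos hNpos hρpos hR (h N hN1 hNM hRN hNR)
  have hX : T ^ (2 * α + 4 / 3) = M ^ 2 * T ^ (4 / 3 : ℝ) := by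
    rw [← hMα, ← Real.rpow_mul_natCast hT0, ← Real.rpow_add hTpos]; push_cast; ring_nf
  have h1 : M ^ (11 / 2 : ℝ) / (ρ * N ^ (1 / 2 : ℝ)) ≤ T ^ (2 * α + 4 / 3) := by
    have e : ρ * N ^ (1 / 2 : ℝ) = N := by
      rw [hρ, Real.sqrt_eq_rpow, ← Real.rpow_add hNpos]; norm_num
    rw [e]
    calc M ^ (11 / 2 : ℝ) / N ≤ M ^ (11 / 2 : ℝ) / T ^ ((3 * α - 1) / 2) :=
          div_le_div_of_nonneg_left (by positivity) (by positivity) hN_ge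
      _ = T ^ (4 * α + 1 / 2) := by
          rw [← hMα]
          simp only [← Real.rpow_mul hT0, ← Real.rpow_sub hTpos]
          congr 1; ring
      _ ≤ T ^ (2 * α + 4 / 3) := Real.rpow_le_rpow_of_exponent_le hT1.le (by linarith)
  have h2 : M ^ 6 / N ^ 3 * (N / ρ) ^ (2 / 3 : ℝ) ≤ T ^ (2 * α + 4 / 3) := by
    have e : M ^ 6 / N ^ 3 * (N / ρ) ^ (2 / 3 : ℝ) = M ^ 6 / N ^ (8 / 3 : ℝ) := by
      rw [hρ, Real.div_sqrt, Real.sqrt_eq_rpow, ← Real.rpow_mul hN0,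
        show M ^ 6 / N ^ 3 * N ^ (1 / 2 * (2 / 3) : ℝ) = M ^ 6 * (N ^ (1 / 2 * (2 / 3) : ℝ) / N ^ ((3 : ℕ) : ℝ))
          by rw [Real.rpow_natCast]; ring,
        ← Real.rpow_sub hNpos, div_eq_mul_inv (M ^ 6), ← Real.rpow_neg hN0]
      congr 2; norm_num
    rw [e]
    calc M ^ 6 / N ^ (8 / 3 : ℝ) ≤ M ^ 6 / (T ^ ((3 * α - 1) / 2)) ^ (8 / 3 : ℝ) := by
          apply div_le_div_of_nonneg_left (by positivity) (by positivity)
          exact Real.rpow_le_rpow (by positivity) hN_ge (by norm_num)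
      _ = T ^ (2 * α + 4 / 3) := by
          rw [← hMα]
          simp only [← Real.rpow_natCast, ← Real.rpow_mul hT0, ← Real.rpow_sub hTpos]
          congr 1; push_cast; ring
  have hM2ε : M ^ (2 + ε) = M ^ 2 * M ^ ε := by
    rw [Real.rpow_add hMpos, show (2 : ℝ) = ((2 : ℕ) : ℝ) by norm_num, Real.rpow_natCast]
  have hCM : 0 ≤ C * M ^ ε := mul_nonneg hC (Real.rpow_nonneg hMpos.le _)
  calc ‖bourgainSum Real.log T M‖ ^ 6
      ≤ C * M ^ ε * (M ^ (11 / 2 : ℝ) / (ρ * N ^ (1 / 2 : ℝ)) +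
          M ^ 6 / N ^ 3 * (N / ρ) ^ (2 / 3 : ℝ)) := hS
    _ ≤ C * M ^ ε * (T ^ (2 * α + 4 / 3) + T ^ (2 * α + 4 / 3)) :=
        mul_le_mul_of_nonneg_left (add_le_add h1 h2) hCM
    _ = 2 * C * M ^ (2 + ε) * T ^ (4 / 3 : ℝ) := by rw [hX, hM2ε]; ring

/-- **Bourgain 2017, (3.16) ⇒ (3.18), for `F = log`.** Hypothesis `h316` is eq. (3.16) of the
paper — "`|S|⁶ ≪ min{M^{ε+11/2} N R^{-7/2}, M^{ε+11/2} R^{-1} N^{-1/2}} + (M^{6+ε}/N³)(N/R)^{2/3}`"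
for every admissible `N` — in the `∀ ε > 0, ∃ C T₀, ∀ T ≥ T₀` rendering of `≪` and under the
standing assumptions of §4 made explicit (`M ≤ √T`; `N ∈ (1, M)` and `R ≤ N ≤ R²` with
`R = ⌈(2M³/(cNT))^{1/2}⌉` as in (3.3)). Conclusion: the three cases of eq. (3.18),
"`|S|⁶ ≪ M^{3+ε} T^{53/57}` if `√T ≥ M > T^{49/114}`; `M^{4+ε} T^{1/2}` if
`T^{49/114} ≥ M ≥ T^{5/12}`; `M^{2+ε} T^{4/3}` if `T^{5/12} > M ≥ 2(cT)^{1/3}`", obtained as in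
the paper by the choices `N = MT^{-17/57}`, `N = M^{1/2} T^{-1/12}` ("`MT^{-17/57} ≫
M^{1/2}T^{-1/12}` if and only if `M ≫ T^{49/114}`") and, below `T^{5/12}` where the former "is too
large to satisfy the condition `N ≤ R²`", `N = (2M³/(cT))^{1/2}`
(`Literature.NumberTheory.LFunctions.eq318_log_case1_of_eq316`, `…case2…`, `…case3…`); "`T`
sufficiently large (in terms of `c⁻¹`)" is `T ≥ max(T₀, (8/c)^{10})`.
[cite: BourgainJAMS2017, §4 eqs. (3.16), (3.17), (3.18)] -/
theorem Bourgain2017_eq318_log_of_eq316 {c : ℝ} (hc : 0 < c) (hc1 : c ≤ 1)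
    (h316 : ∀ ε : ℝ, 0 < ε → ∃ C T₀ : ℝ, ∀ T M N : ℝ, T₀ ≤ T → M ≤ Real.sqrt T →
      1 < N → N < M → (bourgainR c M N T : ℝ) ≤ N → N ≤ (bourgainR c M N T : ℝ) ^ 2 →
        ‖bourgainSum Real.log T M‖ ^ 6 ≤ C * M ^ ε *
          (min (M ^ (11 / 2 : ℝ) * N / (bourgainR c M N T : ℝ) ^ (7 / 2 : ℝ))
              (M ^ (11 / 2 : ℝ) / ((bourgainR c M N T : ℝ) * N ^ (1 / 2 : ℝ))) +
            M ^ 6 / N ^ 3 * (N / (bourgainR c M N T : ℝ)) ^ (2 / 3 : ℝ))) :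
    ∀ ε : ℝ, 0 < ε → ∃ C T₀ : ℝ, ∀ T : ℝ, T₀ ≤ T → ∀ M : ℝ,
      (T ^ (49 / 114 : ℝ) < M → M ≤ Real.sqrt T →
          ‖bourgainSum Real.log T M‖ ^ 6 ≤ C * M ^ (3 + ε) * T ^ (53 / 57 : ℝ)) ∧
      (T ^ (5 / 12 : ℝ) ≤ M → M ≤ T ^ (49 / 114 : ℝ) →
          ‖bourgainSum Real.log T M‖ ^ 6 ≤ C * M ^ (4 + ε) * T ^ (1 / 2 : ℝ)) ∧
      (2 * (c * T) ^ (1 / 3 : ℝ) ≤ M → M < T ^ (5 / 12 : ℝ) →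
          ‖bourgainSum Real.log T M‖ ^ 6 ≤ C * M ^ (2 + ε) * T ^ (4 / 3 : ℝ)) := by
  intro ε hε
  obtain ⟨C, T₀, H⟩ := h316 ε hε
  refine ⟨2 * max C 0, max T₀ ((8 / c) ^ 10), ?_⟩
  intro T hT M
  have hT₀ : T₀ ≤ T := (le_max_left _ _).trans hT
  have hT8 : (8 / c) ^ 10 ≤ T := (le_max_right _ _).trans hT
  obtain ⟨hT1, -⟩ := threshold_basic hc hc1 hT8
  have hC : 0 ≤ max C 0 := le_max_right _ _
  have hsqrt : Real.sqrt T = T ^ (1 / 2 : ℝ) := Real.sqrt_eq_rpow T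
  -- (3.16) at `T`, `M`, with the constant `max C 0 ≥ 0`
  have H' : M ≤ Real.sqrt T → ∀ N : ℝ, 1 < N → N < M → (bourgainR c M N T : ℝ) ≤ N →
      N ≤ (bourgainR c M N T : ℝ) ^ 2 →
      ‖bourgainSum Real.log T M‖ ^ 6 ≤ max C 0 * M ^ ε *
        (min (M ^ (11 / 2 : ℝ) * N / (bourgainR c M N T : ℝ) ^ (7 / 2 : ℝ))
            (M ^ (11 / 2 : ℝ) / ((bourgainR c M N T : ℝ) * N ^ (1 / 2 : ℝ))) +
          M ^ 6 / N ^ 3 * (N / (bourgainR c M N T : ℝ)) ^ (2 / 3 : ℝ)) := by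
    intro hMu N hN1 hNM hRN hNR
    have hM0 : 0 ≤ M := by linarith
    have hN0 : 0 ≤ N := by linarith
    refine (H T M N hT₀ hMu hN1 hNM hRN hNR).trans ?_
    apply mul_le_mul_of_nonneg_right _ (by positivity)
    exact mul_le_mul_of_nonneg_right (le_max_left _ _) (Real.rpow_nonneg hM0 _)
  refine ⟨fun hMl hMu => ?_, fun hMl hMu => ?_, fun hMl hMu => ?_⟩
  · exact eq318_log_case1_of_eq316 hc hc1 hC hT8 hMl (H' hMu)
  · have hMu' : M ≤ Real.sqrt T :=
      hMu.trans (by rw [hsqrt]; exact Real.rpow_le_rpow_of_exponent_le hT1.le (by norm_num))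
    exact eq318_log_case2_of_eq316 hc hc1 hC hT8 hMl hMu (H' hMu')
  · have hMu' : M ≤ Real.sqrt T :=
      hMu.le.trans (by rw [hsqrt]; exact Real.rpow_le_rpow_of_exponent_le hT1.le (by norm_num))
    exact eq318_log_case3_of_eq316 hc hc1 hC hT8 hMl hMu (H' hMu')

/-! ## Theorem 4 from (3.12) and (3.16) -/

/-- **Bourgain 2017, Theorem 4 for `F = log`, from eqs. (3.12) and (3.16)** — the optimisation in
`N` of pp. 11–13 of the paper composed with its last step
(`Literature.NumberTheory.LFunctions.Bourgain2017_theorem4_log_of_eq313_of_eq318`,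
`BourgainTheorem4.lean`): (3.12) gives (3.13) on `cT^{3/7} ≤ M ≤ √T` ⊇ `[T^{3/7}, √T]`
(`Literature.NumberTheory.LFunctions.Bourgain2017_eq313_log_of_eq312`), (3.16) gives (3.18)
(`Literature.NumberTheory.LFunctions.Bourgain2017_eq318_log_of_eq316`), whose third case is
asked by the last step only from `M ≥ 2T^{1/3} ≥ 2(cT)^{1/3}` (`c ≤ 1`). What this leaves of the
printed proof of Theorem 4 is exactly its two displayed inputs (3.12) (= (3.4)–(3.11): the
Bombieri–Iwaniec–Huxley–Watt reduction, the double large sieve, the first spacing bound (3.10)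
from Corollary 3, Huxley–Watt's second spacing bound (3.11)) and (3.16) (= (3.14)–(3.15): the same
with Huxley's resonance-curve second spacing bound), for one constant `c ∈ (0, 1]` in (3.3).
[cite: BourgainJAMS2017, Theorem 4, eq. (3.19); §4 eqs. (3.12)–(3.18)] -/
theorem Bourgain2017_theorem4_log_of_eq312_of_eq316 {c : ℝ} (hc : 0 < c) (hc1 : c ≤ 1)
    (h312 : ∀ ε : ℝ, 0 < ε → ∃ C T₀ : ℝ, ∀ T M N : ℝ, T₀ ≤ T → M ≤ Real.sqrt T →
      N = M * T ^ (-(2 / 7) : ℝ) → 1 < N → N < M →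
      (bourgainR c M N T : ℝ) ≤ N → N ≤ (bourgainR c M N T : ℝ) ^ 2 →
        ‖bourgainSum Real.log T M‖ ^ 6 ≤
          C * (M ^ (6 + ε) / N ^ 3 * (N / (bourgainR c M N T : ℝ))))
    (h316 : ∀ ε : ℝ, 0 < ε → ∃ C T₀ : ℝ, ∀ T M N : ℝ, T₀ ≤ T → M ≤ Real.sqrt T →
      1 < N → N < M → (bourgainR c M N T : ℝ) ≤ N → N ≤ (bourgainR c M N T : ℝ) ^ 2 →
        ‖bourgainSum Real.log T M‖ ^ 6 ≤ C * M ^ ε *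
          (min (M ^ (11 / 2 : ℝ) * N / (bourgainR c M N T : ℝ) ^ (7 / 2 : ℝ))
              (M ^ (11 / 2 : ℝ) / ((bourgainR c M N T : ℝ) * N ^ (1 / 2 : ℝ))) +
            M ^ 6 / N ^ 3 * (N / (bourgainR c M N T : ℝ)) ^ (2 / 3 : ℝ))) :
    Bourgain2017_theorem4_log := by
  refine Bourgain2017_theorem4_log_of_eq313_of_eq318 ?_ ?_
  · intro ε hε
    obtain ⟨C, T₀, H⟩ := Bourgain2017_eq313_log_of_eq312 hc hc1 h312 ε hε
    refine ⟨C, max T₀ 0, fun T hT M hMl hMu => H T ((le_max_left _ _).trans hT) M ?_ hMu⟩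
    have hT0 : 0 ≤ T := (le_max_right _ _).trans hT
    exact (mul_le_of_le_one_left (Real.rpow_nonneg hT0 _) hc1).trans hMl
  · intro ε hε
    obtain ⟨C, T₀, H⟩ := Bourgain2017_eq318_log_of_eq316 hc hc1 h316 ε hε
    refine ⟨C, max T₀ 0, fun T hT M => ?_⟩
    have hT0 : 0 ≤ T := (le_max_right _ _).trans hT
    obtain ⟨-, H2, H3⟩ := H T ((le_max_left _ _).trans hT) M
    refine ⟨H2, fun hMl hMu => H3 ?_ hMu⟩
    calc 2 * (c * T) ^ (1 / 3 : ℝ) ≤ 2 * T ^ (1 / 3 : ℝ) := by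
          apply mul_le_mul_of_nonneg_left _ (by norm_num)
          apply Real.rpow_le_rpow (by positivity) _ (by norm_num)
          exact mul_le_of_le_one_left hT0 hc1
      _ ≤ M := hMl

end Literature.NumberTheory.LFunctions
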